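import Summits.HodgeConjecture.HodgeConjecture.Theorems.F0P3cStCharTSSurjHeckeLin     -- ★ p849718 «SURJ-HECKE★» (H2) (this seat): `shf_torusTransform_of_shells` (binders: level family `C`, `hshell`)
import Summits.HodgeConjecture.HodgeConjecture.Theorems.F0P3cStCharTSTorusChartIso    -- ★ p849607 «CHART-ISO★» (LH6-p01 g2): `torusChartEquiv : M ≃ₜ* T`, `continuous_torusChart`, `torusChart_mem_cmLocalIntegralLevel_iff`
import Summits.HodgeConjecture.HodgeConjecture.Theorems.F0P3cStCharTSTorusLevelBasis  -- ★ p849662 «T-BASIS★» (LH6-p03 g0): `isOpen_coe_subgroupOf_K`, `exists_preimage_K_subset_of_mem_nhds`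
import HarnessLib

/-!
# F0 · P3c · line LH6 «StCharTS» — «LEVEL-FAMILY★»: the level groups `C_n := ι⁻¹(M_T ∩ K_n)` of an Iwahori datum pulled back to the parameter torus `M = E_vˣ × E¹_v` —
# OPEN, inside `M_c`, and a neighbourhood basis of `1`: the binder `C` of ★ p849718 `shf_torusTransform_of_shells` discharged
# [Rogawski1990, §12.7 L. 12.7.1 (proof) p. 191; Casselman1995, §1.4 Prop. 1.4.4 p. 14]

Cell `pub/hodgecm-mathlib`, crux H413 = `stmt-HodgeConjecture-24833` (`--supports` lane, helper), route HCCMUnconditional; seat LH6-p05 (g2); «SURJ-HECKE★» road (desk F0P3b-plan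
(g23) 05:49:42Z; road (D) owner LH6-p03 (g0); (TOR) integrator LH6-p01 (g2)).  THEOREMS ONLY, sorry-free, no definition ∕ instance ∕ notation ∕ named fact.
OBJECTS: for an Iwahori datum `𝓘 : (cmBorelTriple L 3 v).IwahoriDatum` (★ `ParabolicTriple.IwahoriDatum`: compact open levels `𝓘.K n` forming a basis at `1`), the
LEVEL FAMILY on the parameter torus is the INLINE TERM `C n := ((𝓘.K n).subgroupOf (cmBorelTriple L 3 v).M).comap (torusChartHom L v)` (`= ι⁻¹(M_T ∩ K_n)`,
`ι = torusChart` of ★ p849564); `M_c` = the ★ p849333 term.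
* `isOpen_levelFamily` — each `C n` is open (★ T-BASIS `isOpen_coe_subgroupOf_K` + ★ `continuous_torusChart`);
* `levelFamily_le_torusCompactPart` — `C n ≤ M_c` whenever the levels lie in `K_v = U(Φ₃)(𝒪_v)` (★ `torusChart_mem_cmLocalIntegralLevel_iff`, non-split `v`);
* `exists_levelFamily_subset` — the `C n` enter every neighbourhood of `1` in `M` (★ T-BASIS `exists_preimage_K_subset_of_mem_nhds` transported along the
  homeomorphism ★ `torusChartEquiv : M ≃ₜ* M_T`);
* **`shf_torusTransform_of_levelShells`** — ★ p849718 `shf_torusTransform_of_shells` with the level family discharged: the (SHF′) conjunct of ★ p849458 at the named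
  terms `torusTransform`∕`hyperbolicSet`∕`pairChar` MODULO ONLY the shell-transform input `hshell` at the levels of `𝓘` (D3-ii-G ★ p849606 + Ψ-producer + F1-G, road (D)),
  and likewise **`surj_torusTransform_of_levelShells`**.
HONEST LABEL: HC_CM is proved only modulo the 7 printed citations (2 remaining: hLiu418 = stmt-HodgeConjecture-24832, h413 = stmt-HodgeConjecture-24833) until rung 0
closes; count-neutral.

## References
* [Rogawski1990] J. D. Rogawski, *Automorphic Representations of Unitary Groups in Three Variables*, Ann. of Math. Stud. 123 (1990): §12.7 L. 12.7.1 (proof) p. 191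
  (`η^m𝒪^*`-shells and their refinements), §12.2 p. 173.
* [Casselman1995] W. Casselman, *Introduction to the theory of admissible representations of p-adic reductive groups* (1995 notes): §1.4 Prop. 1.4.4 p. 14 (the level
  groups `K_n` form a basis of neighbourhoods of `1`).
-/

set_option autoImplicit false
-- the mandated namespace has the single-problem summit's repeated segment (`HodgeConjecture.HodgeConjecture`)
set_option linter.dupNamespace false

noncomputable section

open NumberField IsDedekindDomain MeasureTheory Measure Topology Filter
open scoped NNReal ENNReal Pointwise MatrixGroups
open Literature.NumberTheory.Rogawski1990 Literature.NumberTheory.Automorphic Literature.NumberTheory.Automorphic.UnitaryGroup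

namespace Summit.HodgeConjecture.HodgeConjecture.Cruxes.H413.F0P3cStCharTSLevelFamily

variable (L : Type) [Field L] [NumberField L] [IsCMField L] (v : HeightOneSpectrum (𝓞 ↥(maximalRealSubfield L)))

/-- **Each `C_n = ι⁻¹(M_T ∩ K_n)` is OPEN** in `M`. Any finite `v`. [cite: Casselman1995, §1.4 Prop. 1.4.4 p. 14] -/
theorem isOpen_levelFamily (𝓘 : (cmBorelTriple L 3 v).IwahoriDatum) (n : ℕ) :
    IsOpen ((((𝓘.K n).subgroupOf (cmBorelTriple L 3 v).M).comap (F0P3cStCharTSTorusDefs.torusChartHom L v) : Subgroup ((UnitaryGroup.LocalRing L v)ˣ × ↥(normOneUnits (conjLocal L (IsCMField.complexConj L) v)))) : Set ((UnitaryGroup.LocalRing L v)ˣ × ↥(normOneUnits (conjLocal L (IsCMField.complexConj L) v)))) := by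
  rw [Subgroup.coe_comap]
  exact (F0P3cStCharTSTorusLevelBasis.isOpen_coe_subgroupOf_K (cmBorelTriple L 3 v) 𝓘 (cmBorelTriple L 3 v).M n).preimage
    (F0P3cStCharTSTorusChartIso.continuous_torusChart L v)

/-- Membership in `C_n`: `m ∈ C_n ↔ ι m ∈ K_n`. [cite: Casselman1995, §1.4 Prop. 1.4.4 p. 14] -/
theorem mem_levelFamily_iff (𝓘 : (cmBorelTriple L 3 v).IwahoriDatum) (n : ℕ) (m : ((UnitaryGroup.LocalRing L v)ˣ × ↥(normOneUnits (conjLocal L (IsCMField.complexConj L) v)))) :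
    m ∈ (((𝓘.K n).subgroupOf (cmBorelTriple L 3 v).M).comap (F0P3cStCharTSTorusDefs.torusChartHom L v) : Subgroup ((UnitaryGroup.LocalRing L v)ˣ × ↥(normOneUnits (conjLocal L (IsCMField.complexConj L) v)))) ↔
      ((F0P3cStCharTSTorusDefs.torusChart L v m : ↥(cmBorelTriple L 3 v).M) :
        ↥(unitaryGroupOfForm (conjLocal L (IsCMField.complexConj L) v) (cmLocalForm L 3 v))) ∈ 𝓘.K n := by
  rw [Subgroup.mem_comap, Subgroup.mem_subgroupOf, F0P3cStCharTSTorusDefs.torusChartHom_apply]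

/-- **`C_n ≤ M_c`** at a non-split `v`, whenever the levels lie inside `K_v = U(Φ₃)(𝒪_v)` (★ `torusChart_mem_cmLocalIntegralLevel_iff`: `ι m ∈ K_v ↔ m ∈ M_c`).
[cite: Rogawski1990, §12.7 L. 12.7.2 (proof) p. 193] [cite: Casselman1995, §1.4 Prop. 1.4.4 p. 14] -/
theorem levelFamily_le_torusCompactPart (hns : ∀ w : PlacesOver L v, IsCMField.complexConj L • w.1 = w.1) (𝓘 : (cmBorelTriple L 3 v).IwahoriDatum)
    (hK : ∀ n, ∀ k ∈ 𝓘.K n, k ∈ cmLocalIntegralLevel L 3 (Matrix.of fun i j : Fin 3 => if i.val + j.val + 1 = 3 then (1 : L) else 0) v) (n : ℕ) :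
    (((𝓘.K n).subgroupOf (cmBorelTriple L 3 v).M).comap (F0P3cStCharTSTorusDefs.torusChartHom L v) : Subgroup ((UnitaryGroup.LocalRing L v)ˣ × ↥(normOneUnits (conjLocal L (IsCMField.complexConj L) v)))) ≤ (((Submonoid.pi Set.univ (fun w : PlacesOver L v => (w.1.adicCompletionIntegers L).toSubring.toSubmonoid)).units.prod (⊤ : Subgroup ↥(normOneUnits (conjLocal L (IsCMField.complexConj L) v)))) : Subgroup ((UnitaryGroup.LocalRing L v)ˣ × ↥(normOneUnits (conjLocal L (IsCMField.complexConj L) v)))) := by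
  intro m hm
  rw [mem_levelFamily_iff] at hm
  exact (F0P3cStCharTSTorusChartIso.torusChart_mem_cmLocalIntegralLevel_iff L v hns m).1 (hK n _ hm)

/-- **The `C_n` enter every neighbourhood of `1` in `M`** (★ T-BASIS on `M_T`, transported along the homeomorphism ★ `torusChartEquiv : M ≃ₜ* M_T`). Any finite `v`.
[cite: Casselman1995, §1.4 Prop. 1.4.4 p. 14] -/
theorem exists_levelFamily_subset (𝓘 : (cmBorelTriple L 3 v).IwahoriDatum) {V : Set ((UnitaryGroup.LocalRing L v)ˣ × ↥(normOneUnits (conjLocal L (IsCMField.complexConj L) v)))} (hV : V ∈ 𝓝 (1 : ((UnitaryGroup.LocalRing L v)ˣ × ↥(normOneUnits (conjLocal L (IsCMField.complexConj L) v))))) :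
    ∃ n : ℕ, ((((𝓘.K n).subgroupOf (cmBorelTriple L 3 v).M).comap (F0P3cStCharTSTorusDefs.torusChartHom L v) : Subgroup ((UnitaryGroup.LocalRing L v)ˣ × ↥(normOneUnits (conjLocal L (IsCMField.complexConj L) v)))) : Set ((UnitaryGroup.LocalRing L v)ˣ × ↥(normOneUnits (conjLocal L (IsCMField.complexConj L) v)))) ⊆ V := by
  let e := F0P3cStCharTSTorusChartIso.torusChartEquiv L v
  have hV' : ⇑e.toHomeomorph '' V ∈ 𝓝 (1 : ↥(cmBorelTriple L 3 v).M) := by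
    have h := e.toHomeomorph.isOpenMap.image_mem_nhds hV
    rwa [show (⇑e.toHomeomorph) 1 = 1 from map_one e] at h
  obtain ⟨n, hn⟩ := F0P3cStCharTSTorusLevelBasis.exists_preimage_K_subset_of_mem_nhds (cmBorelTriple L 3 v) 𝓘 (cmBorelTriple L 3 v).M hV'
  refine ⟨n, fun m hm => ?_⟩
  rw [SetLike.mem_coe, mem_levelFamily_iff] at hm
  obtain ⟨m', hm'V, hm'eq⟩ := hn (Set.mem_preimage.2 hm)
  have hmm : m' = m := e.injective hm'eq
  exact hmm ▸ hm'V

/-- The level family's basis property in the binder shape of ★ p849667 ∕ p849718 (`∀ V ∈ 𝓝 1, ∃ n, ↑(C n) ⊆ V`). [cite: Casselman1995, §1.4 Prop. 1.4.4 p. 14] -/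
theorem levelFamily_basis (𝓘 : (cmBorelTriple L 3 v).IwahoriDatum) :
    ∀ V ∈ 𝓝 (1 : ((UnitaryGroup.LocalRing L v)ˣ × ↥(normOneUnits (conjLocal L (IsCMField.complexConj L) v)))), ∃ n : ℕ, ((((𝓘.K n).subgroupOf (cmBorelTriple L 3 v).M).comap (F0P3cStCharTSTorusDefs.torusChartHom L v) : Subgroup ((UnitaryGroup.LocalRing L v)ˣ × ↥(normOneUnits (conjLocal L (IsCMField.complexConj L) v)))) : Set ((UnitaryGroup.LocalRing L v)ˣ × ↥(normOneUnits (conjLocal L (IsCMField.complexConj L) v)))) ⊆ V :=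
  fun _ hV => exists_levelFamily_subset L v 𝓘 hV

/-- **(SURJ) AT THE LEVELS OF AN IWAHORI DATUM, MODULO ONLY THE SHELL TRANSFORMS** — ★ p849718 `surj_torusTransform_of_shells` with `C n := ι⁻¹(M_T ∩ K_n)` and its three
properties discharged here. [cite: Rogawski1990, §12.7 L. 12.7.1 (proof) p. 191; L. 12.7.2 (proof) p. 194] -/
theorem surj_torusTransform_of_levelShells (hns : ∀ w : PlacesOver L v, IsCMField.complexConj L • w.1 = w.1)
    [MeasurableSpace (Gqs L v)] [BorelSpace (Gqs L v)]
    [∀ γ : Gqs L v, MeasurableSpace (Gqs L v ⧸ Subgroup.centralizer ({γ} : Set (Gqs L v)))]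
    [∀ γ : Gqs L v, BorelSpace (Gqs L v ⧸ Subgroup.centralizer ({γ} : Set (Gqs L v)))]
    (νQv : Measure (Gqs L v)) [νQv.IsHaarMeasure] [νQv.IsMulRightInvariant]
    {mQv : OrbitalMeasureFamily (Gqs L v)} (hcanQ : mQv.IsCanonical (fun γ => IsRegularElt (γ.val : GL (Fin 3) (UnitaryGroup.LocalRing L v))) νQv)
    [MeasurableSpace ((UnitaryGroup.LocalRing L v)ˣ × ↥(normOneUnits (conjLocal L (IsCMField.complexConj L) v)))] (μM : Measure ((UnitaryGroup.LocalRing L v)ˣ × ↥(normOneUnits (conjLocal L (IsCMField.complexConj L) v))))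
    (𝓘 : (cmBorelTriple L 3 v).IwahoriDatum)
    (hK : ∀ n, ∀ k ∈ 𝓘.K n, k ∈ cmLocalIntegralLevel L 3 (Matrix.of fun i j : Fin 3 => if i.val + j.val + 1 = 3 then (1 : L) else 0) v)
    (hshell : ∀ (n : ℕ) (u : ((UnitaryGroup.LocalRing L v)ˣ × ↥(normOneUnits (conjLocal L (IsCMField.complexConj L) v)))), (∀ w : PlacesOver L v, Valued.v ((u.1 : UnitaryGroup.LocalRing L v) w) < 1) →
      ∃ φ : Gqs L v → ℂ, IsLocSmooth φ ∧ tsupport φ ⊆ F0P3cStCharTSTorusDefs.hyperbolicSet L v ∧ ∃ κ : ℂ, κ ≠ 0 ∧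
        F0P3cStCharTSTorusDefs.torusTransform L v mQv μM φ =
          fun m => κ * ((u • ((((𝓘.K n).subgroupOf (cmBorelTriple L 3 v).M).comap (F0P3cStCharTSTorusDefs.torusChartHom L v) : Subgroup ((UnitaryGroup.LocalRing L v)ˣ × ↥(normOneUnits (conjLocal L (IsCMField.complexConj L) v)))) : Set ((UnitaryGroup.LocalRing L v)ˣ × ↥(normOneUnits (conjLocal L (IsCMField.complexConj L) v))))).indicator (fun _ => (1 : ℂ)) m +
            (u • ((((𝓘.K n).subgroupOf (cmBorelTriple L 3 v).M).comap (F0P3cStCharTSTorusDefs.torusChartHom L v) : Subgroup ((UnitaryGroup.LocalRing L v)ˣ × ↥(normOneUnits (conjLocal L (IsCMField.complexConj L) v)))) : Set ((UnitaryGroup.LocalRing L v)ˣ × ↥(normOneUnits (conjLocal L (IsCMField.complexConj L) v))))).indicator (fun _ => (1 : ℂ)) ((fun p : ((UnitaryGroup.LocalRing L v)ˣ × ↥(normOneUnits (conjLocal L (IsCMField.complexConj L) v))) => ((Units.map ((conjLocal L (IsCMField.complexConj L) v : UnitaryGroup.LocalRing L v →+* UnitaryGroup.LocalRing L v) : UnitaryGroup.LocalRing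 L v →* UnitaryGroup.LocalRing L v) p.1)⁻¹, p.2)) m))) :
    ∀ F : ((UnitaryGroup.LocalRing L v)ˣ × ↥(normOneUnits (conjLocal L (IsCMField.complexConj L) v))) → ℂ, IsLocSmooth F → (∀ m : ((UnitaryGroup.LocalRing L v)ˣ × ↥(normOneUnits (conjLocal L (IsCMField.complexConj L) v))), F ((fun p : ((UnitaryGroup.LocalRing L v)ˣ × ↥(normOneUnits (conjLocal L (IsCMField.complexConj L) v))) => ((Units.map ((conjLocal L (IsCMField.complexConj L) v : UnitaryGroup.LocalRing L v →+* UnitaryGroup.LocalRing L v) : UnitaryGroup.LocalRing L v →* UnitaryGroup.LocalRing L v) p.1)⁻¹, p.2)) m) = F m) → (∀ m ∈ (((Submonoid.pi Set.univ (fun w : PlacesOver L v => (w.1.adicCompletionIntegers L).toSubring.toSubmonoid)).units.prod (⊤ : Subgroup ↥(normOneUnits (conjLocal L (IsCMField.complexConj L) v)))) : Subgroup ((UnitaryGroup.LocalRing L v)ˣ × ↥(normOneUnits (conjLocal L (IsCMField.complexConj L) v)))), F m = 0) →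
      ∃ φ : Gqs L v → ℂ, (IsLocSmooth φ ∧ tsupport φ ⊆ F0P3cStCharTSTorusDefs.hyperbolicSet L v) ∧ F0P3cStCharTSTorusDefs.torusTransform L v mQv μM φ = F :=
  F0P3cStCharTSSurjHeckeLin.surj_torusTransform_of_shells L v hns νQv hcanQ μM
    (fun n => ((𝓘.K n).subgroupOf (cmBorelTriple L 3 v).M).comap (F0P3cStCharTSTorusDefs.torusChartHom L v))
    (isOpen_levelFamily L v 𝓘) (levelFamily_le_torusCompactPart L v hns 𝓘 hK) (levelFamily_basis L v 𝓘) hshell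

/-- **(SHF′) AT THE LEVELS OF AN IWAHORI DATUM, MODULO ONLY THE SHELL TRANSFORMS** — the (SHF′) conjunct of ★ p849458 at `torusTransform`∕`hyperbolicSet`∕`pairChar`, from
★ p849718 `shf_torusTransform_of_shells` with the level family `C n := ι⁻¹(M_T ∩ K_n)` discharged here; what remains is `hshell` (road (D) D3-ii-G ★ p849606 + its
Ψ-producer + F1-G ★ `F0P3cStCharTSShellTracePS`, at the levels of `𝓘`) and «`K_n ⊆ K_v`». [cite: Rogawski1990, §12.7 L. 12.7.1 (proof) p. 191; L. 12.7.2 (proof) pp. 193–194] -/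
theorem shf_torusTransform_of_levelShells (hns : ∀ w : PlacesOver L v, IsCMField.complexConj L • w.1 = w.1)
    [MeasurableSpace (Gqs L v)] [BorelSpace (Gqs L v)]
    [∀ γ : Gqs L v, MeasurableSpace (Gqs L v ⧸ Subgroup.centralizer ({γ} : Set (Gqs L v)))]
    [∀ γ : Gqs L v, BorelSpace (Gqs L v ⧸ Subgroup.centralizer ({γ} : Set (Gqs L v)))]
    (νQv : Measure (Gqs L v)) [νQv.IsHaarMeasure] [νQv.IsMulRightInvariant]
    {mQv : OrbitalMeasureFamily (Gqs L v)} (hcanQ : mQv.IsCanonical (fun γ => IsRegularElt (γ.val : GL (Fin 3) (UnitaryGroup.LocalRing L v))) νQv)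
    [MeasurableSpace ((UnitaryGroup.LocalRing L v)ˣ × ↥(normOneUnits (conjLocal L (IsCMField.complexConj L) v)))] (μM : Measure ((UnitaryGroup.LocalRing L v)ˣ × ↥(normOneUnits (conjLocal L (IsCMField.complexConj L) v))))
    (𝓘 : (cmBorelTriple L 3 v).IwahoriDatum)
    (hK : ∀ n, ∀ k ∈ 𝓘.K n, k ∈ cmLocalIntegralLevel L 3 (Matrix.of fun i j : Fin 3 => if i.val + j.val + 1 = 3 then (1 : L) else 0) v)
    (hshell : ∀ (n : ℕ) (u : ((UnitaryGroup.LocalRing L v)ˣ × ↥(normOneUnits (conjLocal L (IsCMField.complexConj L) v)))), (∀ w : PlacesOver L v, Valued.v ((u.1 : UnitaryGroup.LocalRing L v) w) < 1) →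
      ∃ φ : Gqs L v → ℂ, IsLocSmooth φ ∧ tsupport φ ⊆ F0P3cStCharTSTorusDefs.hyperbolicSet L v ∧ ∃ κ : ℂ, κ ≠ 0 ∧
        F0P3cStCharTSTorusDefs.torusTransform L v mQv μM φ =
          fun m => κ * ((u • ((((𝓘.K n).subgroupOf (cmBorelTriple L 3 v).M).comap (F0P3cStCharTSTorusDefs.torusChartHom L v) : Subgroup ((UnitaryGroup.LocalRing L v)ˣ × ↥(normOneUnits (conjLocal L (IsCMField.complexConj L) v)))) : Set ((UnitaryGroup.LocalRing L v)ˣ × ↥(normOneUnits (conjLocal L (IsCMField.complexConj L) v))))).indicator (fun _ => (1 : ℂ)) m +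
            (u • ((((𝓘.K n).subgroupOf (cmBorelTriple L 3 v).M).comap (F0P3cStCharTSTorusDefs.torusChartHom L v) : Subgroup ((UnitaryGroup.LocalRing L v)ˣ × ↥(normOneUnits (conjLocal L (IsCMField.complexConj L) v)))) : Set ((UnitaryGroup.LocalRing L v)ˣ × ↥(normOneUnits (conjLocal L (IsCMField.complexConj L) v))))).indicator (fun _ => (1 : ℂ)) ((fun p : ((UnitaryGroup.LocalRing L v)ˣ × ↥(normOneUnits (conjLocal L (IsCMField.complexConj L) v))) => ((Units.map ((conjLocal L (IsCMField.complexConj L) v : UnitaryGroup.LocalRing L v →+* UnitaryGroup.LocalRing L v) : UnitaryGroup.LocalRing L v →* UnitaryGroup.LocalRing L v) p.1)⁻¹, p.2)) m))) :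
    (∀ χ : (((UnitaryGroup.LocalRing L v)ˣ →* ℂˣ) × (↥(normOneUnits (conjLocal L (IsCMField.complexConj L) v)) →* ℂˣ)), Continuous χ.1 → Continuous χ.2 → ∀ (j : Bool) (m₀ : ((UnitaryGroup.LocalRing L v)ˣ × ↥(normOneUnits (conjLocal L (IsCMField.complexConj L) v)))), m₀ ∉ ((Submonoid.pi Set.univ (fun w : PlacesOver L v => (w.1.adicCompletionIntegers L).toSubring.toSubmonoid)).units.prod (⊤ : Subgroup ↥(normOneUnits (conjLocal L (IsCMField.complexConj L) v)))) → ∃ φ : Gqs L v → ℂ, (IsLocSmooth φ ∧ tsupport φ ⊆ F0P3cStCharTSTorusDefs.hyperbolicSet L v) ∧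
            F0P3cStCharTSTorusDefs.torusTransform L v mQv μM φ = fun m => ((m₀ • ((((Submonoid.pi Set.univ (fun w : PlacesOver L v => (w.1.adicCompletionIntegers L).toSubring.toSubmonoid)).units.prod (⊤ : Subgroup ↥(normOneUnits (conjLocal L (IsCMField.complexConj L) v)))) : Subgroup ((UnitaryGroup.LocalRing L v)ˣ × ↥(normOneUnits (conjLocal L (IsCMField.complexConj L) v)))) : Set ((UnitaryGroup.LocalRing L v)ˣ × ↥(normOneUnits (conjLocal L (IsCMField.complexConj L) v))))).indicator (fun m => (((F0P3cStCharTSTorusDefs.pairChar L v (cond j (conjInvChar (conjLocal L (IsCMField.complexConj L) v) χ.1, χ.2) χ)) m₀ : ℂˣ) : ℂ) * ((((F0P3cStCharTSTorusDefs.pairChar L v (cond j (conjInvChar (conjLocal L (IsCMField.complexConj L) v) χ.1, χ.2) χ)) m)⁻¹ : ℂˣ) : ℂ)) m) + ((m₀ • ((((Submonoid.pi Set.univ (fun w : PlacesOver L v => (w.1.adicCompletionIntegers L).toSubring.toSubmonoid)).units.prod (⊤ : Subgroup ↥(normOneUnits (conjLocal L (IsCMField.complexConj L) v)))) : Subgroup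 ((UnitaryGroup.LocalRing L v)ˣ × ↥(normOneUnits (conjLocal L (IsCMField.complexConj L) v)))) : Set ((UnitaryGroup.LocalRing L v)ˣ × ↥(normOneUnits (conjLocal L (IsCMField.complexConj L) v))))).indicator (fun m => (((F0P3cStCharTSTorusDefs.pairChar L v (cond j (conjInvChar (conjLocal L (IsCMField.complexConj L) v) χ.1, χ.2) χ)) m₀ : ℂˣ) : ℂ) * ((((F0P3cStCharTSTorusDefs.pairChar L v (cond j (conjInvChar (conjLocal L (IsCMField.complexConj L) v) χ.1, χ.2) χ)) m)⁻¹ : ℂˣ) : ℂ)) ((Units.map ((conjLocal L (IsCMField.complexConj L) v : UnitaryGroup.LocalRing L v →+* UnitaryGroup.LocalRing L v) : UnitaryGroup.LocalRing L v →* UnitaryGroup.LocalRing L v) m.1)⁻¹, m.2))) :=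
  F0P3cStCharTSSurjHeckeLin.shf_torusTransform_of_shells L v hns νQv hcanQ μM
    (fun n => ((𝓘.K n).subgroupOf (cmBorelTriple L 3 v).M).comap (F0P3cStCharTSTorusDefs.torusChartHom L v))
    (isOpen_levelFamily L v 𝓘) (levelFamily_le_torusCompactPart L v hns 𝓘 hK) (levelFamily_basis L v 𝓘) hshell

end Summit.HodgeConjecture.HodgeConjecture.Cruxes.H413.F0P3cStCharTSLevelFamily

end
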